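import Summits.BirchSwinnertonDyer.BirchSwinnertonDyer.Theorems.QuadraticBranchSignedControlPlusEtaNonsurjBDMTVPrimes
import Summits.BirchSwinnertonDyer.BirchSwinnertonDyer.Theorems.QuadraticBranchSignedControlPlusEtaNonsurjCMRowsUniform
import HarnessLib

/-!
# Route `QuadraticBranchSignedControl` (rung K8, cell `bsd-potss`): crux stmt-BirchSwinnertonDyer-19606
# `PlusEtaMainConjectureNonsurj` — THE NON-CM WINDOW: modulo Serre's uniformity question (`SerreUniformityBound 37`, OPEN, hypothesis)
# and BDMTV 2019/2023 (named facts), the NON-CM content of the crux — skeleton v7's transfer road and its hardest stub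
# `stub_etaMC_nonCM_uncongruent` — is supported on the EIGHT primes `{5, 7, 11, 19, 23, 29, 31, 37}`; above `37` the crux needs the CM inputs ONLY

WHAT. k8eta-c2 g0 (`…CartanRows`): under `SerreUniformityBound 37` a non-CM row has `p ≤ 37`; k8eta-c2 g17 (`…BDMTVPrimes`): at `p ∈ {13, 17}`
every row is CM and the node follows from v7's CM inputs alone; this seat (`…CMRowsUniform`): at `p > 37` with no inert class-number-one field
the crux is vacuous under uniformity. This file assembles the three into the statements the planner can cite:

* §1 `hasCM_of_row_of_serreUniformityBound_of_gt_37` — under uniformity every row at `p > 37` is CM (Serre's lifting lemma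
  `serre_hasSurjectiveModNGaloisRep_pow_holds`: onto mod `p` ⟹ onto tower); `quadraticBranchPlusEtaAt_of_cmInputs_of_serreUniformityBound_of_gt_37`
  — **at every `p > 37` the node (C1⁺_η) follows from v7's CM inputs (`h22 h6273 h26 hAcm hμcm`) ALONE, given uniformity** (no Corpuz–Lei
  binder, no `stub_etaMC_nonCM_uncongruent`).
* §2 `plusEtaMainConjectureNonsurj_of_cmConjA_of_transfer_of_uncongruent_window` — **the crux BY NAME** through k8eta-c2 g8's v7 composition
  with the hardest stub required ONLY for `5 ≤ p ≤ 37 ∧ p ≠ 13 ∧ p ≠ 17`, given `SerreUniformityBound 37` + BDMTV; and the finite-list form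
  `…_eight_primes` with the stub quantified over `p ∈ {5, 7, 11, 19, 23, 29, 31, 37}` (`prime_window_iff`, `decide`).
* §3 `plusEtaMainConjectureNonsurj_of_cmRows_of_nonCMRows_window` — the stub-free shape (g0's `…_of_cmRows_of_nonCMCartanRows` with the
  non-CM hypothesis restricted to the same eight primes).

HONEST FRAMING (cell `bsd-potss`; FULL-BSD rank ≤ 1 programme): bookkeeping / composition theorems; no definition, no named fact, no `sorry`, axioms
standard. EVERYTHING here is CONDITIONAL on the displayed hypotheses — `SerreUniformityBound 37` is an OPEN QUESTION (Serre 1972/1981; Zywina,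
Furio–Lombardo 2023: known bounds are not uniform), BDMTV 2019/2023 are published theorems typed as facts, the v7 inputs are what they are (two cite-level
facts, one OPEN preprint binder, (A) and the analytic `μ` on the CM rows, the uncongruent stub). Nothing is closed; crux 19606 stays OPEN;
`BSD(W, p)` is claimed for no pair. Seat `bsd-potss-k8eta-c2` g18 (prover), `--supports stmt-BirchSwinnertonDyer-19606`.

References: [SerreKyoto1977] question 6.5 (p. 187); [Serre1981] §8; [FurioLombardo2023] §1; [Zywina2015] Prop. 1.14 / §4; [BalakrishnanEtAl2019]
Cor. 1.3; [BalakrishnanEtAl2023] Thm. 1.2; [SerreAbelianLadic1968] IV-23 Lemma 3 (lifting); [Kobayashi2003] §4 (p. 8); [BurungaleTian2026] Thm. 2.6;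
[CorpuzLei2025] Thms 1–3 (claim); [CoatesSujatha2005] §3 (A).
-/

set_option autoImplicit false
set_option linter.dupNamespace false

noncomputable section

open scoped Classical

open CongruenceSubgroup Field WeierstrassCurve Literature.NumberTheory.EllipticCurves
  Literature.NumberTheory.EllipticCurves.ModularForms Literature.NumberTheory.GaloisRepresentations
  Literature.NumberTheory.EllipticCurves.Rank1Residual Literature.NumberTheory.EllipticCurves.Rank1Residual.Typed
  Literature.NumberTheory.EllipticCurves.GreenbergVatsal2000 Literature.NumberTheory.SerreUniformity ZpExtension
  Summit.BirchSwinnertonDyer.Rank1Residual.Additive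
  Summit.BirchSwinnertonDyer.BirchSwinnertonDyer.Theses.QuadraticBranchSignedControl
open Summit.BirchSwinnertonDyer.Rank1Residual.O6 (ModPCongruent)

namespace Summit.BirchSwinnertonDyer.BirchSwinnertonDyer.Theorems.EtaBDMTVPrimes

/-! ## §1 Above `37`: every row is CM (under uniformity); the node from the CM inputs alone -/

/-- **Under `SerreUniformityBound 37` every row of crux 19606 at a prime `p > 37` is CM**: a non-CM `V` would have `ρ̄_{V,p}` onto, hence
(Serre's lifting lemma, tree theorem `serre_hasSurjectiveModNGaloisRep_pow_holds`, `p ≥ 5`) the whole `p`-adic tower onto — not a row.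
[cite: SerreKyoto1977, question 6.5, p. 187] [cite: SerreAbelianLadic1968, Ch. IV §3.4 Lemma 3] -/
theorem hasCM_of_row_of_serreUniformityBound_of_gt_37 (hS : SerreUniformityBound 37) (V : WeierstrassCurve ℚ) [V.IsElliptic]
    [V.IsGloballyMinimal] (p : ℕ) [Fact p.Prime] (hp37 : 37 < p)
    (hns : ¬ ∀ m : ℕ, V.HasSurjectiveModNGaloisRep (p ^ m : ℕ)) : V.HasCM := by
  by_contra hCM
  exact hns (serre_hasSurjectiveModNGaloisRep_pow_holds V p (by omega) (hS V hCM p Fact.out hp37))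

/-- **At every prime `p > 37`, GIVEN `SerreUniformityBound 37`, the node (C1⁺_η) at a row follows from skeleton v7's CM INPUTS ALONE**
(Kobayashi Thm 2.2η / 6.2–6.3–7.3 i), Burungale–Tian Thm 2.6, (A) on the CM partners, analytic `μ = 0` on the CM rows — through k8eta-c2 g7's
`EtaFineRoad.etaMC_cm_of_bt26_of_conjA_partners_of_analyticMu`): no Corpuz–Lei binder, no uncongruent stub. The twin of g17's
`quadraticBranchPlusEtaMainConjectureAt_of_cmInputs_of_eq_13_or_17` (there BDMTV, here uniformity). CONDITIONAL; nothing booked.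
[cite: SerreKyoto1977, question 6.5] [cite: BurungaleTian2026, Thm. 2.6] [cite: Kobayashi2003, Thm. 2.2, §4 (p. 8), Thm. 7.3 i)]
[cite: CoatesSujatha2005, §3 statement (A)] -/
theorem quadraticBranchPlusEtaAt_of_cmInputs_of_serreUniformityBound_of_gt_37 (hS : SerreUniformityBound 37)
    (h22 : Kobayashi2003.thm22_etaSignedSelmerDual_finite_torsion)
    (h6273 : Kobayashi2003.thm62_63_73_etaColemanPoitouTate)
    (h26 : BurungaleTian2026.thm26_etaKatoSequences_charIdeal_upToP_of_cm)
    (hAcm : ∀ (V : WeierstrassCurve ℚ) [V.IsElliptic] [V.IsGloballyMinimal] (W : WeierstrassCurve ℚ) [W.IsElliptic]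
      [W.IsGloballyMinimal] (C : VariableChange ℚ) (p : ℕ) [Fact p.Prime],
      5 ≤ p → C • W.quadraticTwist ((-1) ^ (p / 2) * p) = V →
      V.HasGoodReductionAtPrime p → V.frobeniusTrace p = 0 →
      ¬ (∀ m : ℕ, V.HasSurjectiveModNGaloisRep (p ^ m : ℕ)) → V.HasCM →
      ∀ (κ : ZpExtension ℚ p), κ.IsCyclotomic →
        ∃ (γ : absoluteGaloisGroup ℚ) (D : W.FineSelmerDualData κ γ),
          Module.Finite ℤ_[p] (RestrictScalars ℤ_[p] (IwasawaAlgebra p) D.X))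
    (hμcm : ∀ (V : WeierstrassCurve ℚ) [V.IsElliptic] [V.IsGloballyMinimal] (p : ℕ) [Fact p.Prime],
      5 ≤ p → V.HasGoodReductionAtPrime p → V.frobeniusTrace p = 0 →
      ¬ (∀ m : ℕ, V.HasSurjectiveModNGaloisRep (p ^ m : ℕ)) → V.HasCM →
      ∀ {N : ℕ} [NeZero N] {f : CuspForm (Gamma0 N) 2}, IsNewformOf V f →
        ∀ (ϖ : ℚ), (if Even (p / 2) then (ϖ : ℝ) * V.realPeriodRat = plusPeriod f
            else (ϖ : ℝ) * V.imaginaryPeriodRat = minusPeriod f) →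
        ∀ (Lη : IwasawaAlgebra p), IsQuadraticBranchPlusLFunction f p ϖ Lη → HasUnitContent Lη)
    (V : WeierstrassCurve ℚ) [V.IsElliptic] [V.IsGloballyMinimal] (p : ℕ) [Fact p.Prime] (hp37 : 37 < p)
    (hgood : V.HasGoodReductionAtPrime p) (hap : V.frobeniusTrace p = 0)
    (hns : ¬ ∀ m : ℕ, V.HasSurjectiveModNGaloisRep (p ^ m : ℕ)) :
    QuadraticBranchPlusEtaMainConjectureAt V p :=
  EtaFineRoad.etaMC_cm_of_bt26_of_conjA_partners_of_analyticMu h26 h22 h6273 hAcm hμcm V p (by omega) hgood hap hns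
    (hasCM_of_row_of_serreUniformityBound_of_gt_37 hS V p hp37 hns)

/-! ## §2 The crux BY NAME with the hardest stub on the window `5 ≤ p ≤ 37`, `p ∉ {13, 17}` -/

/-- **A prime `p` with `5 ≤ p ≤ 37`, `p ∉ {13, 17}` is one of `5, 7, 11, 19, 23, 29, 31, 37`.** (`decide` over the window.) [folklore] -/
theorem prime_window_iff (p : ℕ) (hp : p.Prime) :
    (5 ≤ p ∧ p ≤ 37 ∧ p ≠ 13 ∧ p ≠ 17) ↔ p ∈ ({5, 7, 11, 19, 23, 29, 31, 37} : Finset ℕ) := by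
  constructor
  · rintro ⟨h5, h37, h13, h17⟩
    interval_cases p <;> simp_all (config := { decide := true })
  · intro h
    simp only [Finset.mem_insert, Finset.mem_singleton] at h
    rcases h with rfl | rfl | rfl | rfl | rfl | rfl | rfl | rfl <;> omega

/-- **THE CRUX `PlusEtaMainConjectureNonsurj` BY NAME with the hardest stub on the NON-CM WINDOW.** The v7 composition (k8eta-c2 g8,
`EtaCMCongruentTransfer.plusEtaMainConjectureNonsurj_of_cmConjA_of_transfer_of_uncongruent`) with the text of `stub_etaMC_nonCM_uncongruent`
required ONLY for `5 ≤ p ≤ 37`, `p ≠ 13`, `p ≠ 17` — GIVEN `SerreUniformityBound 37` (OPEN; above `37` every row is CM, §1) and BDMTV 2019/2023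
(at `13`, `17` every row is CM, g17). CONDITIONAL on all displayed inputs (two cite-level facts, the OPEN Corpuz–Lei binder, (A) + analytic `μ` on
the CM rows, the windowed stub, uniformity, BDMTV); closes nothing by itself; nothing booked.
[cite: SerreKyoto1977, question 6.5] [cite: BalakrishnanEtAl2019, Cor. 1.3] [cite: BalakrishnanEtAl2023, Thm. 1.2]
[claim: CorpuzLei2025, status: under-review] [cite: BurungaleTian2026, Thm. 2.6] [cite: Kobayashi2003, Thm. 2.2, §4 (p. 8), Thm. 7.3 i), Cor. 7.2]
[cite: CoatesSujatha2005, §3 statement (A)] [cite: GreenbergVatsal2000, Thm. (1.4)] -/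
theorem plusEtaMainConjectureNonsurj_of_cmConjA_of_transfer_of_uncongruent_window (hS : SerreUniformityBound 37)
    (h13 : BDMTV2019_nonsplitCartan_level13) (h17 : BDMTV2023_nonsplitCartan_level17)
    (h22 : Kobayashi2003.thm22_etaSignedSelmerDual_finite_torsion)
    (h6273 : Kobayashi2003.thm62_63_73_etaColemanPoitouTate)
    (h26 : BurungaleTian2026.thm26_etaKatoSequences_charIdeal_upToP_of_cm)
    (hCL : CorpuzLei2025_etaPlusMainConjecture_transfer_anMu_OPEN)
    (hAcm : ∀ (V : WeierstrassCurve ℚ) [V.IsElliptic] [V.IsGloballyMinimal] (W : WeierstrassCurve ℚ) [W.IsElliptic]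
      [W.IsGloballyMinimal] (C : VariableChange ℚ) (p : ℕ) [Fact p.Prime],
      5 ≤ p → C • W.quadraticTwist ((-1) ^ (p / 2) * p) = V →
      V.HasGoodReductionAtPrime p → V.frobeniusTrace p = 0 →
      ¬ (∀ m : ℕ, V.HasSurjectiveModNGaloisRep (p ^ m : ℕ)) → V.HasCM →
      ∀ (κ : ZpExtension ℚ p), κ.IsCyclotomic →
        ∃ (γ : absoluteGaloisGroup ℚ) (D : W.FineSelmerDualData κ γ),
          Module.Finite ℤ_[p] (RestrictScalars ℤ_[p] (IwasawaAlgebra p) D.X))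
    (hμcm : ∀ (V : WeierstrassCurve ℚ) [V.IsElliptic] [V.IsGloballyMinimal] (p : ℕ) [Fact p.Prime],
      5 ≤ p → V.HasGoodReductionAtPrime p → V.frobeniusTrace p = 0 →
      ¬ (∀ m : ℕ, V.HasSurjectiveModNGaloisRep (p ^ m : ℕ)) → V.HasCM →
      ∀ {N : ℕ} [NeZero N] {f : CuspForm (Gamma0 N) 2}, IsNewformOf V f →
        ∀ (ϖ : ℚ), (if Even (p / 2) then (ϖ : ℝ) * V.realPeriodRat = plusPeriod f
            else (ϖ : ℝ) * V.imaginaryPeriodRat = minusPeriod f) →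
        ∀ (Lη : IwasawaAlgebra p), IsQuadraticBranchPlusLFunction f p ϖ Lη → HasUnitContent Lη)
    (huncong : ∀ (V : WeierstrassCurve ℚ) [V.IsElliptic] [V.IsGloballyMinimal] (p : ℕ) [Fact p.Prime],
      5 ≤ p → p ≤ 37 → p ≠ 13 → p ≠ 17 → V.HasGoodReductionAtPrime p → V.frobeniusTrace p = 0 →
      ¬ (∀ m : ℕ, V.HasSurjectiveModNGaloisRep (p ^ m : ℕ)) → ¬ V.HasCM →
      ¬ (∃ (V'' : WeierstrassCurve ℚ) (_ : V''.IsElliptic) (_ : V''.IsGloballyMinimal),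
          V''.HasCM ∧ V''.HasGoodReductionAtPrime p ∧ V''.frobeniusTrace p = 0 ∧ ModPCongruent V'' V p) →
      QuadraticBranchPlusEtaMainConjectureAt V p) :
    PlusEtaMainConjectureNonsurj := by
  refine plusEtaMainConjectureNonsurj_of_cmConjA_of_transfer_of_uncongruent_off_13_17 h13 h17 h22 h6273 h26 hCL hAcm hμcm ?_
  intro V _ _ p _ hp5 hp13 hp17 hgood hap hns hncm hcg
  by_cases hp37 : 37 < p
  · exact absurd (hasCM_of_row_of_serreUniformityBound_of_gt_37 hS V p hp37 hns) hncm
  · exact huncong V p hp5 (by omega) hp13 hp17 hgood hap hns hncm hcg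

/-- **The same with the hardest stub quantified over the EIGHT primes `{5, 7, 11, 19, 23, 29, 31, 37}`** — the complete list of primes at which,
modulo Serre uniformity and BDMTV, skeleton v7 asks anything of a non-CM row not congruent to a CM row. (In-table censuses of the lineage reach
`5`, `7`, `11`; nothing is known in print about non-CM points of `X_ns⁺(p)` for `p ∈ {19, 23, 29, 31, 37}` beyond their expected absence.)
[cite: SerreKyoto1977, question 6.5] [cite: BalakrishnanEtAl2019, Cor. 1.3] [cite: BalakrishnanEtAl2023, Thm. 1.2] [claim: CorpuzLei2025, status: under-review] -/
theorem plusEtaMainConjectureNonsurj_of_cmConjA_of_transfer_of_uncongruent_eight_primes (hS : SerreUniformityBound 37)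
    (h13 : BDMTV2019_nonsplitCartan_level13) (h17 : BDMTV2023_nonsplitCartan_level17)
    (h22 : Kobayashi2003.thm22_etaSignedSelmerDual_finite_torsion)
    (h6273 : Kobayashi2003.thm62_63_73_etaColemanPoitouTate)
    (h26 : BurungaleTian2026.thm26_etaKatoSequences_charIdeal_upToP_of_cm)
    (hCL : CorpuzLei2025_etaPlusMainConjecture_transfer_anMu_OPEN)
    (hAcm : ∀ (V : WeierstrassCurve ℚ) [V.IsElliptic] [V.IsGloballyMinimal] (W : WeierstrassCurve ℚ) [W.IsElliptic]
      [W.IsGloballyMinimal] (C : VariableChange ℚ) (p : ℕ) [Fact p.Prime],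
      5 ≤ p → C • W.quadraticTwist ((-1) ^ (p / 2) * p) = V →
      V.HasGoodReductionAtPrime p → V.frobeniusTrace p = 0 →
      ¬ (∀ m : ℕ, V.HasSurjectiveModNGaloisRep (p ^ m : ℕ)) → V.HasCM →
      ∀ (κ : ZpExtension ℚ p), κ.IsCyclotomic →
        ∃ (γ : absoluteGaloisGroup ℚ) (D : W.FineSelmerDualData κ γ),
          Module.Finite ℤ_[p] (RestrictScalars ℤ_[p] (IwasawaAlgebra p) D.X))
    (hμcm : ∀ (V : WeierstrassCurve ℚ) [V.IsElliptic] [V.IsGloballyMinimal] (p : ℕ) [Fact p.Prime],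
      5 ≤ p → V.HasGoodReductionAtPrime p → V.frobeniusTrace p = 0 →
      ¬ (∀ m : ℕ, V.HasSurjectiveModNGaloisRep (p ^ m : ℕ)) → V.HasCM →
      ∀ {N : ℕ} [NeZero N] {f : CuspForm (Gamma0 N) 2}, IsNewformOf V f →
        ∀ (ϖ : ℚ), (if Even (p / 2) then (ϖ : ℝ) * V.realPeriodRat = plusPeriod f
            else (ϖ : ℝ) * V.imaginaryPeriodRat = minusPeriod f) →
        ∀ (Lη : IwasawaAlgebra p), IsQuadraticBranchPlusLFunction f p ϖ Lη → HasUnitContent Lη)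
    (huncong : ∀ (V : WeierstrassCurve ℚ) [V.IsElliptic] [V.IsGloballyMinimal] (p : ℕ) [Fact p.Prime],
      p ∈ ({5, 7, 11, 19, 23, 29, 31, 37} : Finset ℕ) → V.HasGoodReductionAtPrime p → V.frobeniusTrace p = 0 →
      ¬ (∀ m : ℕ, V.HasSurjectiveModNGaloisRep (p ^ m : ℕ)) → ¬ V.HasCM →
      ¬ (∃ (V'' : WeierstrassCurve ℚ) (_ : V''.IsElliptic) (_ : V''.IsGloballyMinimal),
          V''.HasCM ∧ V''.HasGoodReductionAtPrime p ∧ V''.frobeniusTrace p = 0 ∧ ModPCongruent V'' V p) →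
      QuadraticBranchPlusEtaMainConjectureAt V p) :
    PlusEtaMainConjectureNonsurj :=
  plusEtaMainConjectureNonsurj_of_cmConjA_of_transfer_of_uncongruent_window hS h13 h17 h22 h6273 h26 hCL hAcm hμcm
    fun V _ _ p _ hp5 hp37 hp13 hp17 hgood hap hns hncm hcg =>
      huncong V p ((prime_window_iff p Fact.out).mp ⟨hp5, hp37, hp13, hp17⟩) hgood hap hns hncm hcg

/-! ## §3 The stub-free shape: CM rows + non-CM rows on the eight primes -/

/-- **The crux from (C1⁺_η) on the CM rows and on the non-CM `X_ns⁺(p)` rows at the EIGHT primes `{5, 7, 11, 19, 23, 29, 31, 37}`**, given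
`SerreUniformityBound 37` and BDMTV 2019/2023 (g0's `plusEtaMainConjectureNonsurj_of_cmRows_of_nonCMCartanRows` + §1 + g0's
`nonCMCartanRows_off_13_17`). CONDITIONAL; nothing booked. [cite: SerreKyoto1977, question 6.5] [cite: BalakrishnanEtAl2019, Cor. 1.3]
[cite: BalakrishnanEtAl2023, Thm. 1.2] [cite: Kobayashi2003, §4 (p. 8)] -/
theorem plusEtaMainConjectureNonsurj_of_cmRows_of_nonCMRows_window (hS : SerreUniformityBound 37)
    (h13 : BDMTV2019_nonsplitCartan_level13) (h17 : BDMTV2023_nonsplitCartan_level17)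
    (hCM : ∀ (V : WeierstrassCurve ℚ) [V.IsElliptic] [V.IsGloballyMinimal] (p : ℕ) [Fact p.Prime],
        5 ≤ p → V.HasGoodReductionAtPrime p → V.frobeniusTrace p = 0 → V.HasCM →
        QuadraticBranchPlusEtaMainConjectureAt V p)
    (hNS : ∀ (V : WeierstrassCurve ℚ) [V.IsElliptic] [V.IsGloballyMinimal] (p : ℕ) [Fact p.Prime],
        p ∈ ({5, 7, 11, 19, 23, 29, 31, 37} : Finset ℕ) → V.HasGoodReductionAtPrime p → V.frobeniusTrace p = 0 →
        ¬ V.HasCM → HasModPImageEqNonsplitCartanNormalizer V p → QuadraticBranchPlusEtaMainConjectureAt V p) :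
    PlusEtaMainConjectureNonsurj := by
  refine plusEtaMainConjectureNonsurj_of_cmRows_of_nonCMCartanRows_off_13_17 h13 h17 hCM ?_
  intro V _ _ p _ hp5 hp13 hp17 hgood hap hncm hC
  have hp37 : p ≤ 37 := nonCMCartanRows_le_37_of_serreUniformityBound hS V p hncm hC
  exact hNS V p ((prime_window_iff p Fact.out).mp ⟨hp5, hp37, hp13, hp17⟩) hgood hap hncm hC

end Summit.BirchSwinnertonDyer.BirchSwinnertonDyer.Theorems.EtaBDMTVPrimes

end
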